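/-
Copyright (c) 2026 the pub-hodgecm-mathlib formalisation cell (harness21).  Prover seat hodgecm-mathlib-F0P3-p01 (g24); E1 keeper ∕ dealer F0P3a-p03 (g30), E1 BRICK LEDGER
row 59 «K2′∕K4′-UNR ASSEMBLY HEADS» — GLUE F, THE FINAL ASSEMBLY «EP-NORM-ONE @ UNR» (§1: in row 58's 3-TERM letters, the pseudo-coefficient head as the one named binder
`hpc3`; §2 = ONE application of ★-to-be S2a, appended when it lands) (2026-09-03).
-/
import Summits.HodgeConjecture.HodgeConjecture.Theorems.F0P3cStCharTSEPTraceOneAtDatum      -- ★ row 59 datum halves (this seat) p853501∕p853506: `innerG_char_self_eq_one_of_isPseudoCoeff_epTwoFamilies`; brings ★ PCT-OUT, ★ 57-B, ★ F-gen2, ★ EP-TRACE-ONE, ★ 48-datum FILE 1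
import Summits.HodgeConjecture.HodgeConjecture.Theorems.F0P3cStCharTSTreeOrbitDataGqs       -- ★ row 59 (this seat): `exists_vertexOrbitData_gqs` (`ι₀ := Bool`), `exists_edgeOrbitData_gqs` (`ι₁ := Unit`) based at an edge `d₁`
import Summits.HodgeConjecture.HodgeConjecture.Theorems.F0P3cStCharTSK1UnrPseudoCoeffWitness  -- ★ row 58 FILE 1 (LH5-p02): S2a `isPseudoCoeff_epFunction_of_unramified_explicit` (its `h61` = ★ 61b inside)
import HarnessLib

/-!
# F0 · P3c · line LH6 «StCharTS» — E1 row 59 GLUE F, THE FINAL ASSEMBLY «EP-NORM-ONE @ UNR»: `⟨χ_σ, χ_σ⟩_e = 1` for every irreducible smooth `σ` of `U(Φ₃)(L⁺_v)` (`v`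
# non-split UNRAMIFIED) whose smooth self-extensions split — in the 3-TERM letters of row 58's witnessed pseudo-coefficient head (K2′ `hL2oneNsNW` ∕ K4′ `hLdsOne` UNR riders)

Cell `pub/hodgecm-mathlib` (D-0151), crux H413 = `stmt-HodgeConjecture-24833` (`--supports` lane, helper, THEOREMS ONLY: no definition ∕ instance ∕ notation ∕ named fact ∕ `sorry`;
count-neutral: closes no node).  Namespace `Summit.HodgeConjecture.HodgeConjecture.Cruxes.H413.F0P3cStCharTSEPNormOneUnr`.  Seat F0P3-p01 (g24); census `CENSUS-R59-K2K4-UNR.v1`;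
keeper 03:28:00Z «GLUE F → YOU», 04:03:39Z «= cut part 1 ∕ part 2», 04:12:32Z «YOU — the Gqs-level orbit letters».

THE MATHEMATICS [Rogawski1990 §12.6 Prop. 12.6.1 (a) p. 188: «`⟨χ_π, χ_π⟩_e = 1`»; Schneider–Stuhler 1997 §III.4: `Tr π(f_EP^π) = EP(π, π)`].  At the cell's (G3)-EXPLICIT one-place
model `(w hw ϖ hd eA)` of an unramified non-split `v`, with the action hom ∕ unitary level family `(a, U)` at level `ϖ^(e+1)` (★ 41g-H), a base edge `d₁` of the tree with its
vertex ∕ edge stabilisers `P₀ = Stab(τ.head d₁)`, `P₂ = Stab(τ.tail d₁)`, `P₁ = Stab(d₁)`, an irreducible smooth `r` with a non-zero `U_{x₀}`-fixed vector, the three local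
representations `τ₀ τ₂ τ₁` of the stabilisers on `V^{U_head}`, `V^{U_tail}`, `V^{U_head ⊔ U_tail}` and their `K`-type pieces `f₀ f₂ f₁` (EXACTLY the letters of ★ 48-datum FILE 2
and of row 58's witnessed head S2a `isPseudoCoeff_epFunction_of_unramified_explicit`), and a §12.5 datum `𝔇` with ★ PCT-OUT's letters:
  IF `f := μ(P₀)⁻¹ f₀ + μ(P₂)⁻¹ f₂ − μ(P₁)⁻¹ f₁` is a pseudo-coefficient of `σ = [r]` (`hpc3` — row 58 S2a) and every SMOOTH self-extension of `r.ρ` splits (`hsplit` — ★ 40″ at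
  `π²(ξ)` through row 63's realisation, ★ 46″ at the l.d.s. members through row 64), THEN **`𝔇.innerG (𝔇.char σ) (𝔇.char σ) = 1`**.
PROOF (§1): ★ `exists_vertexOrbitData_gqs` ∕ `exists_edgeOrbitData_gqs` based at `d₁` make `(τ.head d₁, τ.tail d₁ ; d₁)` orbit representatives with `ι₀ := Bool`, `ι₁ := Unit`; the
families `xv := cond · head tail`, `P := cond · P₀ P₂`, `σ₀ := Bool.rec τ₂ τ₀` (dependent, reduces on the constructors), `f := cond · f₀ f₂`, and `xe := d₁`, `P₁`, `τ₁`, `f₁` on `Unit`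
are fed to ★ `innerG_char_self_eq_one_of_isPseudoCoeff_epTwoFamilies`; its two-family EP function IS `f` (`Fintype.sum_bool`, `Fintype.sum_unique`), so `hpc3` is its `hpc`.  NO `IsL2` ∕
`IsEllipticRep` ∕ unitarity letter anywhere.
* §1 **`innerG_char_self_eq_one_of_isPseudoCoeff_epThree`** — the final assembly modulo the ONE named binder `hpc3` (= S2a's conclusion, token for token in its letters).
* §2 (ED. 2) **`innerG_char_self_eq_one_of_unramified_explicit`** = §1 with `hpc3 := ★ S2a …` — the organ-facing K2′∕K4′-UNR head modulo `hsplit` (GLUE G re-letters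
  `hL2oneNsNW` ∕ `hLdsOne` in the junction; rider pen).
HONEST LABEL: count-neutral helper ((R-SS) banked PAYDOWN-UNR for K1 only; K2′∕K4′ ride on the LEAD's word, T15-39; E1 = PRINT until the charter test); h413 OPEN; HC_CM is proved
only modulo the 7 printed citations (2 remaining named inputs hLiu418 = stmt-HodgeConjecture-24832, h413 = stmt-HodgeConjecture-24833) until rung 0 closes; nothing printed is
asserted here.

## References
* [Rogawski1990] J. D. Rogawski, *Automorphic Representations of Unitary Groups in Three Variables*, Ann. of Math. Stud. 123 (1990): §12.6 Prop. 12.6.1 (a) p. 188; §12.6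
  p. 187 (pseudo-coefficients, `Tr π′(f_π) = ⟨χ_{π′}, χ_π⟩_e`); §12.5 pp. 182–187.
* [SchneiderStuhler1997] P. Schneider, U. Stuhler, *Representation theory and sheaves on the Bruhat–Tits building*, Publ. Math. IHÉS 85 (1997): §III.4.
* [Kottwitz1988] R. E. Kottwitz, *Tamagawa numbers*, Ann. of Math. 127 (1988): §2.
* [BruhatTits1972] F. Bruhat, J. Tits, *Groupes réductifs sur un corps local I*, Publ. Math. IHÉS 41 (1972): §10.
-/

set_option autoImplicit false

set_option linter.dupNamespace false

noncomputable section

open NumberField IsDedekindDomain MeasureTheory Measure Filter Topology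
open scoped Pointwise Valued WithZero Matrix MatrixGroups BigOperators
open Literature.NumberTheory.Rogawski1990 Literature.NumberTheory.Rogawski1990.Ch12Sec5
open Literature.NumberTheory.Automorphic Literature.NumberTheory.Automorphic.UnitaryGroup Literature.NumberTheory.Automorphic.UnitaryLatticeTree
open Literature.NumberTheory.Automorphic.HermitianLattice Literature.NumberTheory.GaloisRepresentations
open Literature.Combinatorics.SimpleGraph Literature.Combinatorics.SimpleGraph.OrientedIncidence

namespace Summit.HodgeConjecture.HodgeConjecture.Cruxes.H413.F0P3cStCharTSEPNormOneUnr

open Summit.HodgeConjecture.HodgeConjecture.Cruxes.H413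
open Summit.HodgeConjecture.HodgeConjecture.Cruxes.H413.F0P3cStCharTSEPTraceOneAtDatum
open Summit.HodgeConjecture.HodgeConjecture.Cruxes.H413.F0P3cStCharTSTreeOrbitDataGqs

section Head

variable (L : Type) [Field L] [NumberField L] [IsCMField L] (v : HeightOneSpectrum (𝓞 ↥(maximalRealSubfield L)))

/-- **EP-NORM-ONE @ UNR, in row 58's 3-TERM letters — `⟨χ_σ, χ_σ⟩_e = 1` MODULO the pseudo-coefficient head.**  For the base edge `d₁` with stabilisers `P₀ P₂ P₁`
(`hP₀ hP₂ hP₁`), the local representations `τ₀ τ₂ τ₁` (coercion laws `hτρᵢ`, trivial on the levels `hτᵢ`), the `K`-type pieces `f₀ f₂ f₁` (★ 42 letters `hfPᵢ hf0ᵢ`), an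
irreducible smooth `r` with `r.ρ.fixedPoints (U x₀) ≠ ⊥`, `hsplit`, and `hpc3 : 𝔇.IsPseudoCoeff [r] (μ(P₀)⁻¹ f₀ + μ(P₂)⁻¹ f₂ − μ(P₁)⁻¹ f₁)` (row 58 S2a's conclusion, token for token):
`𝔇.innerG (𝔇.char [r]) (𝔇.char [r]) = 1`.  Proof: the orbit data based at `d₁` (★ `exists_vertexOrbitData_gqs`, `ι₀ := Bool`; ★ `exists_edgeOrbitData_gqs`, `ι₁ := Unit`) turns
`(P₀, P₂ ; P₁)`, `(τ₀, τ₂ ; τ₁)`, `(f₀, f₂ ; f₁)` into ★ 57-B's families, and ★ `innerG_char_self_eq_one_of_isPseudoCoeff_epTwoFamilies` applies — its two-family EP function is this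
3-term `f` (`Fintype.sum_bool`, `Fintype.sum_unique`). [cite: Rogawski1990, §12.6 Prop. 12.6.1 (a) p. 188] [cite: SchneiderStuhler1997, §III.4] [cite: Kottwitz1988, §2] -/
theorem innerG_char_self_eq_one_of_isPseudoCoeff_epThree
    (hns : ∀ w : PlacesOver L v, IsCMField.complexConj L • w.1 = w.1)
    (w : PlacesOver L v) (hw : IsCMField.complexConj L • w.1 = w.1) {ϖ : (w.1.adicCompletion L)} (hd : UnramifiedLocalConjDatum (galAdicCompletionMap (L := L) (IsCMField.complexConj L) hw) ϖ)
    (eA : (Gqs L v) ≃ₜ* ↥(unitaryGroupOfForm (galAdicCompletionMap (L := L) (IsCMField.complexConj L) hw) ((StdForm.antidiagonal 3).over (w.1.adicCompletion L))))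
    {a : (Gqs L v) →* ((latticeGraph (galAdicCompletionMap (L := L) (IsCMField.complexConj L) hw) ϖ ((StdForm.antidiagonal 3).over (w.1.adicCompletion L))) ≃g (latticeGraph (galAdicCompletionMap (L := L) (IsCMField.complexConj L) hw) ϖ ((StdForm.antidiagonal 3).over (w.1.adicCompletion L))))} (ha : ∀ g, a g = latticeGraphIso (galAdicCompletionMap (L := L) (IsCMField.complexConj L) hw) ϖ ((StdForm.antidiagonal 3).over (w.1.adicCompletion L)) (eA g))
    [MeasurableSpace (Gqs L v)] [BorelSpace (Gqs L v)]
    [∀ γ : Gqs L v, MeasurableSpace (Gqs L v ⧸ Subgroup.centralizer ({γ} : Set (Gqs L v)))] [MeasurableSpace (Gqs L v ⧸ Subgroup.center (Gqs L v))]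
    {H : Type} [Group H] [TopologicalSpace H] [IsTopologicalGroup H] [MeasurableSpace H]
    (νQv : Measure (Gqs L v)) [νQv.IsHaarMeasure] [νQv.IsMulRightInvariant]
    -- the §12.5 datum and ★ PCT-OUT's letters
    (𝔇 : EllipticData (Gqs L v) H) (hμG : 𝔇.μG = νQv)
    (hreg : ∀ γ : Gqs L v, γ ∈ 𝔇.regG ↔ IsRegularElt (γ.val : GL (Fin 3) (UnitaryGroup.LocalRing L v)))
    (hM1 : ∀ π : IrrClass (Gqs L v), Measurable (𝔇.char π) ∧ LocallyIntegrable (𝔇.char π) 𝔇.μG ∧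
      (∀ x ∈ 𝔇.regG, ∀ᶠ y in 𝓝 x, 𝔇.char π y = 𝔇.char π x) ∧
      ∀ φ : Gqs L v → ℂ, IsLocSmooth φ → π.smoothTrace 𝔇.μG φ = ∫ x, φ x * 𝔇.char π x ∂𝔇.μG)
    (hWIF : 𝔇.WeylIntegrationFormula) (hC1 : 𝔇.EllCartanSubset) (hC2 : 𝔇.EllCartanAE) (hC3 : 𝔇.NonEllCartanAE) (hL2 : 𝔇.L2CharOnTorusAll)
    (τ : Orientation (latticeGraph (galAdicCompletionMap (L := L) (IsCMField.complexConj L) hw) ϖ ((StdForm.antidiagonal 3).over (w.1.adicCompletion L)))) (hτ : ∀ d, τ.tail d < τ.head d)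
    {e : ℕ} {U : {M : Submodule 𝒪[(w.1.adicCompletion L)] (Fin 3 → (w.1.adicCompletion L)) // IsVertex (galAdicCompletionMap (L := L) (IsCMField.complexConj L) hw) ϖ ((StdForm.antidiagonal 3).over (w.1.adicCompletion L)) M} → Subgroup (Gqs L v)}
    (hU : ∀ x g, g ∈ U x ↔ mapGL ((eA g : ↥(unitaryGroupOfForm (galAdicCompletionMap (L := L) (IsCMField.complexConj L) hw) ((StdForm.antidiagonal 3).over (w.1.adicCompletion L)))) : GL (Fin 3) (w.1.adicCompletion L)) x.1 = x.1 ∧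
      x.1.map ((Matrix.toLin' ((((eA g : ↥(unitaryGroupOfForm (galAdicCompletionMap (L := L) (IsCMField.complexConj L) hw) ((StdForm.antidiagonal 3).over (w.1.adicCompletion L)))) : GL (Fin 3) (w.1.adicCompletion L)) : Matrix (Fin 3) (Fin 3) (w.1.adicCompletion L)) - 1)).restrictScalars 𝒪[(w.1.adicCompletion L)]) ≤ scaleLattice (ϖ ^ (e + 1)) x.1)
    -- the base edge and its stabilisers (★ 48-datum ∕ row 58 letters)
    (d₁ : (latticeGraph (galAdicCompletionMap (L := L) (IsCMField.complexConj L) hw) ϖ ((StdForm.antidiagonal 3).over (w.1.adicCompletion L))).edgeSet) (P₀ P₂ P₁ : Subgroup (Gqs L v))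
    (hP₀ : ∀ g, g ∈ P₀ ↔ a g (τ.head d₁) = τ.head d₁) (hP₂ : ∀ g, g ∈ P₂ ↔ a g (τ.tail d₁) = τ.tail d₁) (hP₁ : ∀ g, g ∈ P₁ ↔ (a g).mapEdgeSet d₁ = d₁)
    (r : SmoothIrrep (Gqs L v)) (he : ∃ x₀ : {M : Submodule 𝒪[(w.1.adicCompletion L)] (Fin 3 → (w.1.adicCompletion L)) // IsVertex (galAdicCompletionMap (L := L) (IsCMField.complexConj L) hw) ϖ ((StdForm.antidiagonal 3).over (w.1.adicCompletion L)) M}, r.ρ.fixedPoints (U x₀) ≠ ⊥)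
    -- the three local representations and their `K`-type pieces (★ 48-datum ∕ row 58 letters)
    (τ₀ : Representation ℂ ↥P₀ ↥(r.ρ.fixedPoints (U (τ.head d₁))))
    (hτρ₀ : ∀ (p : ↥P₀) (x : ↥(r.ρ.fixedPoints (U (τ.head d₁)))), ((τ₀ p x : ↥(r.ρ.fixedPoints (U (τ.head d₁)))) : r.V) = r.ρ (p : (Gqs L v)) (x : r.V))
    (τ₂ : Representation ℂ ↥P₂ ↥(r.ρ.fixedPoints (U (τ.tail d₁))))
    (hτρ₂ : ∀ (p : ↥P₂) (x : ↥(r.ρ.fixedPoints (U (τ.tail d₁)))), ((τ₂ p x : ↥(r.ρ.fixedPoints (U (τ.tail d₁)))) : r.V) = r.ρ (p : (Gqs L v)) (x : r.V))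
    (τ₁ : Representation ℂ ↥P₁ ↥(r.ρ.fixedPoints (U (τ.head d₁) ⊔ U (τ.tail d₁))))
    (hτρ₁ : ∀ (p : ↥P₁) (x : ↥(r.ρ.fixedPoints (U (τ.head d₁) ⊔ U (τ.tail d₁)))), ((τ₁ p x : ↥(r.ρ.fixedPoints (U (τ.head d₁) ⊔ U (τ.tail d₁)))) : r.V) = r.ρ (p : (Gqs L v)) (x : r.V))
    {f₀ f₂ f₁ : (Gqs L v) → ℂ}
    (hfP₀ : ∀ (g : (Gqs L v)) (hg : g ∈ P₀), f₀ g = Representation.character τ₀ ⟨g, hg⟩⁻¹) (hf0₀ : ∀ g ∉ P₀, f₀ g = 0)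
    (hfP₂ : ∀ (g : (Gqs L v)) (hg : g ∈ P₂), f₂ g = Representation.character τ₂ ⟨g, hg⟩⁻¹) (hf0₂ : ∀ g ∉ P₂, f₂ g = 0)
    (hfP₁ : ∀ (g : (Gqs L v)) (hg : g ∈ P₁), f₁ g = Representation.character τ₁ ⟨g, hg⟩⁻¹) (hf0₁ : ∀ g ∉ P₁, f₁ g = 0)
    -- every SMOOTH self-extension of `σ` splits (★ 40″ ∕ ★ 46″ at the families)
    (hsplit : ∀ (E : Type) [AddCommGroup E] [Module ℂ E] (ρE : Representation ℂ (Gqs L v) E), ρE.IsSmooth →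
      ∀ (i : r.ρ.IntertwiningMap ρE) (p : ρE.IntertwiningMap r.ρ), Function.Injective i → LinearMap.ker p.toLinearMap = LinearMap.range i.toLinearMap →
        Function.Surjective p → ∃ s : r.ρ.IntertwiningMap ρE, p.comp s = Representation.IntertwiningMap.id r.ρ)
    -- row 58's witnessed head S2a: the 3-term EP function IS a pseudo-coefficient of `σ = [r]`
    (hpc3 : 𝔇.IsPseudoCoeff (IrrClass.mk r)
      ((((νQv.real (P₀ : Set (Gqs L v)))⁻¹ : ℂ)) • f₀ + (((νQv.real (P₂ : Set (Gqs L v)))⁻¹ : ℂ)) • f₂ - (((νQv.real (P₁ : Set (Gqs L v)))⁻¹ : ℂ)) • f₁)) :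
    𝔇.innerG (𝔇.char (IrrClass.mk r)) (𝔇.char (IrrClass.mk r)) = 1 := by
  classical
  obtain ⟨x₀, hx₀⟩ := he
  -- the orbit data based at `d₁` (★ TreeOrbitDataGqs)
  obtain ⟨idx₀, tr₀, hidx₀, hidx₀a, htr₀⟩ := exists_vertexOrbitData_gqs L v w hw hd eA ha τ hτ d₁
  obtain ⟨tr₁, htr₁⟩ := exists_edgeOrbitData_gqs L v w hw hd eA ha τ hτ d₁
  -- the Bool-indexed vertex families built from `(P₀, τ₀, f₀ ; P₂, τ₂, f₂)` and the Unit-indexed edge family `(P₁, τ₁, f₁)`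
  let σ₀ : ∀ b : Bool, Representation ℂ ↥(cond b P₀ P₂) ↥(r.ρ.fixedPoints (U (cond b (τ.head d₁) (τ.tail d₁)))) := fun b =>
    match b with
    | true => τ₀
    | false => τ₂
  have hP : ∀ (b : Bool) (g : Gqs L v), g ∈ cond b P₀ P₂ ↔ a g (cond b (τ.head d₁) (τ.tail d₁)) = cond b (τ.head d₁) (τ.tail d₁) := fun b => by
    cases b
    · exact hP₂
    · exact hP₀
  have hσ₀ : ∀ (b : Bool) (p : ↥(cond b P₀ P₂)) (x : ↥(r.ρ.fixedPoints (U (cond b (τ.head d₁) (τ.tail d₁))))),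
      ((σ₀ b p x : ↥(r.ρ.fixedPoints (U (cond b (τ.head d₁) (τ.tail d₁))))) : r.V) = r.ρ (p : Gqs L v) (x : r.V) := fun b => by
    cases b
    · exact hτρ₂
    · exact hτρ₀
  have hfP : ∀ (b : Bool) (g : Gqs L v) (hg : g ∈ cond b P₀ P₂), cond b f₀ f₂ g = (σ₀ b).character ⟨g, hg⟩⁻¹ := fun b => by
    cases b
    · exact hfP₂
    · exact hfP₀
  have hf0 : ∀ (b : Bool), ∀ g ∉ cond b P₀ P₂, cond b f₀ f₂ g = 0 := fun b => by
    cases b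
    · exact hf0₂
    · exact hf0₀
  -- the two-family EP function of these families is the 3-term `f`
  have hf : ((∑ b : Bool, ((νQv.real (cond b P₀ P₂ : Set (Gqs L v)) : ℂ))⁻¹ • cond b f₀ f₂) -
      ∑ _u : Unit, ((νQv.real (P₁ : Set (Gqs L v)) : ℂ))⁻¹ • f₁) =
      (((νQv.real (P₀ : Set (Gqs L v)))⁻¹ : ℂ)) • f₀ + (((νQv.real (P₂ : Set (Gqs L v)))⁻¹ : ℂ)) • f₂ - (((νQv.real (P₁ : Set (Gqs L v)))⁻¹ : ℂ)) • f₁ := by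
    rw [Fintype.sum_bool, Fintype.sum_unique]
    rfl
  have hpc : 𝔇.IsPseudoCoeff (IrrClass.mk r) ((∑ b : Bool, ((νQv.real (cond b P₀ P₂ : Set (Gqs L v)) : ℂ))⁻¹ • cond b f₀ f₂) -
      ∑ _u : Unit, ((νQv.real (P₁ : Set (Gqs L v)) : ℂ))⁻¹ • f₁) := by
    rw [hf]; exact hpc3
  exact innerG_char_self_eq_one_of_isPseudoCoeff_epTwoFamilies L v hns w hw hd eA ha νQv 𝔇 hμG hreg hM1 hWIF hC1 hC2 hC3 hL2 τ hτ hU r hx₀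
    (fun b => cond b (τ.head d₁) (τ.tail d₁)) idx₀ tr₀ hidx₀ hidx₀a htr₀ (fun b => cond b P₀ P₂) hP σ₀ hσ₀
    (fun _ : Unit => d₁) (fun _ => ()) tr₁ (fun _ => rfl) (fun _ _ => rfl) (fun d => htr₁ d) (fun _ => P₁) (fun _ => hP₁) (fun _ => τ₁) (fun _ => hτρ₁)
    (f₀ := fun b => cond b f₀ f₂) hfP hf0 (f₁ := fun _ => f₁) (fun _ => hfP₁) (fun _ => hf0₁) hsplit hpc

/-! ## §2 (ED. 2, append-only) THE FINAL APPLICATION: `hpc3 := ★ S2a` (row 58 FILE 1 `isPseudoCoeff_epFunction_of_unramified_explicit`) -/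

open F0P3cStCharTSTorusDefs in   -- `hyperbolicSet` (the `hE` letter, S2a's binder verbatim)
/-- **EP-NORM-ONE @ UNR, (G3)-EXPLICIT — `⟨χ_σ, χ_σ⟩_e = 1` for every irreducible smooth `σ = [r]` of `U(Φ₃)(L⁺_v)` (`v` non-split unramified) whose smooth self-extensions
split.**  §1 with its ONE row-58 binder discharged: `hpc3 := ★ S2a isPseudoCoeff_epFunction_of_unramified_explicit … (IrrClass.mk r) rfl` (row 58 FILE 1, LH5-p02; its own
`h61` input is ★ 61b inside that file).  Binders = S2a's VERBATIM (the (G3)-EXPLICIT block with `heA`, the §12.5 datum with `mQv hcanQ horb hreg hE hM1`, the level family with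
`hUo hUc hEo hEc`, the APARTMENT base edge `d₁` pinned by `hd₁ : d₁ = s(A 0, A 1)`, the stabilisers, `r` with `he`, the three finite-dimensionality instances, the `K`-type letters
`τᵢ hτρᵢ hτᵢ fᵢ hfPᵢ hf0ᵢ`) + ★ PCT-OUT's `hWIF hC1 hC2 hC3 hL2` + `hsplit` (the FAMILY input: ★ 40″+63-C∕D for `π²(ξ)`, (S5) for every `L²` class, ★ 46″+68 for the l.d.s.
members).  This is row 59's organ-facing K2′∕K4′-UNR head modulo `hsplit` (= row-66 DOCK CERT v4 `dock1`); the junction re-letters `hL2oneNsNW` ∕ `hLdsOne` through it (GLUE G).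
NO `IsL2` ∕ `IsEllipticRep` ∕ unitarity letter. [cite: Rogawski1990, §12.6 Prop. 12.6.1 (a) p. 188] [cite: SchneiderStuhler1997, §III.4] [cite: Kottwitz1988, §2] -/
theorem innerG_char_self_eq_one_of_unramified_explicit
    (hns : ∀ w : PlacesOver L v, IsCMField.complexConj L • w.1 = w.1)
    (w : PlacesOver L v) (hw : IsCMField.complexConj L • w.1 = w.1) {ϖ : w.1.adicCompletion L} (hd : UnramifiedLocalConjDatum (galAdicCompletionMap (L := L) (IsCMField.complexConj L) hw) ϖ)
    (eA : Gqs L v ≃ₜ* ↥(unitaryGroupOfForm (galAdicCompletionMap (L := L) (IsCMField.complexConj L) hw) ((StdForm.antidiagonal 3).over (w.1.adicCompletion L))))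
    (heA : ∀ g : Gqs L v, ((eA g : ↥(unitaryGroupOfForm (galAdicCompletionMap (L := L) (IsCMField.complexConj L) hw) ((StdForm.antidiagonal 3).over (w.1.adicCompletion L)))) : GL (Fin 3) (w.1.adicCompletion L)) = ((localNonsplitEquiv (IsCMField.complexConj L) (qsForm L) (IsCMField.complexConj_ne_one L) w hw g : ↥(unitaryGroupOfForm (galAdicCompletionMap (L := L) (IsCMField.complexConj L) hw) (placeForm (qsForm L) w.1))) : GL (Fin 3) (w.1.adicCompletion L)))
    [MeasurableSpace (Gqs L v)] [BorelSpace (Gqs L v)]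
    [∀ γ : Gqs L v, MeasurableSpace (Gqs L v ⧸ Subgroup.centralizer ({γ} : Set (Gqs L v)))] [∀ γ : Gqs L v, BorelSpace (Gqs L v ⧸ Subgroup.centralizer ({γ} : Set (Gqs L v)))]
    [MeasurableSpace (Gqs L v ⧸ Subgroup.center (Gqs L v))]
    {H : Type} [Group H] [TopologicalSpace H] [IsTopologicalGroup H] [MeasurableSpace H]
    (νQv : Measure (Gqs L v)) [νQv.IsHaarMeasure] [νQv.IsMulRightInvariant] (mQv : OrbitalMeasureFamily (Gqs L v))
    (hcanQ : mQv.IsCanonical (fun γ => IsRegularElt (γ.val : GL (Fin 3) (UnitaryGroup.LocalRing L v))) νQv)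
    (𝔇 : EllipticData (Gqs L v) H) (hμG : 𝔇.μG = νQv) (horb : 𝔇.orb = mQv)
    (hreg : ∀ γ : Gqs L v, γ ∈ 𝔇.regG ↔ IsRegularElt (γ.val : GL (Fin 3) (UnitaryGroup.LocalRing L v)))
    (hE : ∀ γ : Gqs L v, γ ∈ 𝔇.ellG ↔ IsRegularElt (γ.val : GL (Fin 3) (UnitaryGroup.LocalRing L v)) ∧ γ ∉ hyperbolicSet L v)
    (hM1 : ∀ π : IrrClass (Gqs L v), Measurable (𝔇.char π) ∧ LocallyIntegrable (𝔇.char π) 𝔇.μG ∧ (∀ x ∈ 𝔇.regG, ∀ᶠ y in 𝓝 x, 𝔇.char π y = 𝔇.char π x) ∧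
      ∀ φ : Gqs L v → ℂ, IsLocSmooth φ → π.smoothTrace 𝔇.μG φ = ∫ x, φ x * 𝔇.char π x ∂𝔇.μG)
    (hWIF : 𝔇.WeylIntegrationFormula) (hC1 : 𝔇.EllCartanSubset) (hC2 : 𝔇.EllCartanAE) (hC3 : 𝔇.NonEllCartanAE) (hL2 : 𝔇.L2CharOnTorusAll)   -- ★ PCT-OUT's extra letters
    {a : (Gqs L v) →* ((latticeGraph (galAdicCompletionMap (L := L) (IsCMField.complexConj L) hw) ϖ ((StdForm.antidiagonal 3).over (w.1.adicCompletion L))) ≃g (latticeGraph (galAdicCompletionMap (L := L) (IsCMField.complexConj L) hw) ϖ ((StdForm.antidiagonal 3).over (w.1.adicCompletion L))))} (ha : ∀ g, a g = latticeGraphIso (galAdicCompletionMap (L := L) (IsCMField.complexConj L) hw) ϖ ((StdForm.antidiagonal 3).over (w.1.adicCompletion L)) (eA g))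
    (τ : Orientation (latticeGraph (galAdicCompletionMap (L := L) (IsCMField.complexConj L) hw) ϖ ((StdForm.antidiagonal 3).over (w.1.adicCompletion L)))) (hτ : ∀ d, τ.tail d < τ.head d)
    {e : ℕ} {U : {M : Submodule 𝒪[(w.1.adicCompletion L)] (Fin 3 → (w.1.adicCompletion L)) // IsVertex (galAdicCompletionMap (L := L) (IsCMField.complexConj L) hw) ϖ ((StdForm.antidiagonal 3).over (w.1.adicCompletion L)) M} → Subgroup (Gqs L v)}
    (hU : ∀ x g, g ∈ U x ↔ mapGL ((eA g : ↥(unitaryGroupOfForm (galAdicCompletionMap (L := L) (IsCMField.complexConj L) hw) ((StdForm.antidiagonal 3).over (w.1.adicCompletion L)))) : GL (Fin 3) (w.1.adicCompletion L)) x.1 = x.1 ∧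
    x.1.map ((Matrix.toLin' ((((eA g : ↥(unitaryGroupOfForm (galAdicCompletionMap (L := L) (IsCMField.complexConj L) hw) ((StdForm.antidiagonal 3).over (w.1.adicCompletion L)))) : GL (Fin 3) (w.1.adicCompletion L)) : Matrix (Fin 3) (Fin 3) (w.1.adicCompletion L)) - 1)).restrictScalars 𝒪[(w.1.adicCompletion L)]) ≤ scaleLattice (ϖ ^ (e + 1)) x.1)
    (hUo : ∀ x, IsOpen (U x : Set (Gqs L v))) (hUc : ∀ x, IsCompact (U x : Set (Gqs L v)))
    (hEo : ∀ d : (latticeGraph (galAdicCompletionMap (L := L) (IsCMField.complexConj L) hw) ϖ ((StdForm.antidiagonal 3).over (w.1.adicCompletion L))).edgeSet, IsOpen ((U (τ.head d) ⊔ U (τ.tail d) : Subgroup (Gqs L v)) : Set (Gqs L v)))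
    (hEc : ∀ d : (latticeGraph (galAdicCompletionMap (L := L) (IsCMField.complexConj L) hw) ϖ ((StdForm.antidiagonal 3).over (w.1.adicCompletion L))).edgeSet, IsCompact ((U (τ.head d) ⊔ U (τ.tail d) : Subgroup (Gqs L v)) : Set (Gqs L v)))
    {A : ℤ → {M : Submodule 𝒪[(w.1.adicCompletion L)] (Fin 3 → (w.1.adicCompletion L)) // IsVertex (galAdicCompletionMap (L := L) (IsCMField.complexConj L) hw) ϖ ((StdForm.antidiagonal 3).over (w.1.adicCompletion L)) M}} (hA0 : ∀ c : ℤ, (A (2 * c)).1 = latt (Matrix.diagonal ![ϖ ^ c, (1 : w.1.adicCompletion L), ϖ ^ (-c)])) (hA1 : ∀ c : ℤ, (A (2 * c + 1)).1 = latt (Matrix.diagonal ![ϖ ^ (c + 1), (1 : w.1.adicCompletion L), ϖ ^ (-c)]))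
    (d₁ : (latticeGraph (galAdicCompletionMap (L := L) (IsCMField.complexConj L) hw) ϖ ((StdForm.antidiagonal 3).over (w.1.adicCompletion L))).edgeSet) (hd₁ : (d₁ : Sym2 {M : Submodule 𝒪[(w.1.adicCompletion L)] (Fin 3 → (w.1.adicCompletion L)) // IsVertex (galAdicCompletionMap (L := L) (IsCMField.complexConj L) hw) ϖ ((StdForm.antidiagonal 3).over (w.1.adicCompletion L)) M}) = s(A 0, A 1)) (P₀ P₂ P₁ : Subgroup (Gqs L v))
    (hP₀ : ∀ g, g ∈ P₀ ↔ a g (τ.head d₁) = τ.head d₁) (hP₂ : ∀ g, g ∈ P₂ ↔ a g (τ.tail d₁) = τ.tail d₁) (hP₁ : ∀ g, g ∈ P₁ ↔ (a g).mapEdgeSet d₁ = d₁)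
    (r : SmoothIrrep (Gqs L v)) (he : ∃ x₀ : {M : Submodule 𝒪[(w.1.adicCompletion L)] (Fin 3 → (w.1.adicCompletion L)) // IsVertex (galAdicCompletionMap (L := L) (IsCMField.complexConj L) hw) ϖ ((StdForm.antidiagonal 3).over (w.1.adicCompletion L)) M}, r.ρ.fixedPoints (U x₀) ≠ ⊥)
    [FiniteDimensional ℂ ↥(r.ρ.fixedPoints (U (τ.head d₁)))] [FiniteDimensional ℂ ↥(r.ρ.fixedPoints (U (τ.tail d₁)))]
    [FiniteDimensional ℂ ↥(r.ρ.fixedPoints (U (τ.head d₁) ⊔ U (τ.tail d₁)))]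
    (τ₀ : Representation ℂ ↥P₀ ↥(r.ρ.fixedPoints (U (τ.head d₁))))
    (hτρ₀ : ∀ (p : ↥P₀) (x : ↥(r.ρ.fixedPoints (U (τ.head d₁)))), ((τ₀ p x : ↥(r.ρ.fixedPoints (U (τ.head d₁)))) : r.V) = r.ρ (p : (Gqs L v)) (x : r.V))
    (hτ₀ : ∀ p : ↥P₀, (p : (Gqs L v)) ∈ U (τ.head d₁) → τ₀ p = 1)
    (τ₂ : Representation ℂ ↥P₂ ↥(r.ρ.fixedPoints (U (τ.tail d₁))))
    (hτρ₂ : ∀ (p : ↥P₂) (x : ↥(r.ρ.fixedPoints (U (τ.tail d₁)))), ((τ₂ p x : ↥(r.ρ.fixedPoints (U (τ.tail d₁)))) : r.V) = r.ρ (p : (Gqs L v)) (x : r.V))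
    (hτ₂ : ∀ p : ↥P₂, (p : (Gqs L v)) ∈ U (τ.tail d₁) → τ₂ p = 1)
    (τ₁ : Representation ℂ ↥P₁ ↥(r.ρ.fixedPoints (U (τ.head d₁) ⊔ U (τ.tail d₁))))
    (hτρ₁ : ∀ (p : ↥P₁) (x : ↥(r.ρ.fixedPoints (U (τ.head d₁) ⊔ U (τ.tail d₁)))), ((τ₁ p x : ↥(r.ρ.fixedPoints (U (τ.head d₁) ⊔ U (τ.tail d₁)))) : r.V) = r.ρ (p : (Gqs L v)) (x : r.V))
    (hτ₁ : ∀ p : ↥P₁, (p : (Gqs L v)) ∈ U (τ.head d₁) ⊔ U (τ.tail d₁) → τ₁ p = 1)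
    {f₀ f₂ f₁ : (Gqs L v) → ℂ}
    (hfP₀ : ∀ (g : (Gqs L v)) (hg : g ∈ P₀), f₀ g = Representation.character τ₀ ⟨g, hg⟩⁻¹) (hf0₀ : ∀ g ∉ P₀, f₀ g = 0)
    (hfP₂ : ∀ (g : (Gqs L v)) (hg : g ∈ P₂), f₂ g = Representation.character τ₂ ⟨g, hg⟩⁻¹) (hf0₂ : ∀ g ∉ P₂, f₂ g = 0)
    (hfP₁ : ∀ (g : (Gqs L v)) (hg : g ∈ P₁), f₁ g = Representation.character τ₁ ⟨g, hg⟩⁻¹) (hf0₁ : ∀ g ∉ P₁, f₁ g = 0)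
    -- every SMOOTH self-extension of `σ` splits (the FAMILY input)
    (hsplit : ∀ (E : Type) [AddCommGroup E] [Module ℂ E] (ρE : Representation ℂ (Gqs L v) E), ρE.IsSmooth →
      ∀ (i : r.ρ.IntertwiningMap ρE) (p : ρE.IntertwiningMap r.ρ), Function.Injective i → LinearMap.ker p.toLinearMap = LinearMap.range i.toLinearMap →
        Function.Surjective p → ∃ s : r.ρ.IntertwiningMap ρE, p.comp s = Representation.IntertwiningMap.id r.ρ) :
    𝔇.innerG (𝔇.char (IrrClass.mk r)) (𝔇.char (IrrClass.mk r)) = 1 :=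
  innerG_char_self_eq_one_of_isPseudoCoeff_epThree L v hns w hw hd eA ha νQv 𝔇 hμG hreg hM1 hWIF hC1 hC2 hC3 hL2 τ hτ hU d₁ P₀ P₂ P₁ hP₀ hP₂ hP₁ r he
    τ₀ hτρ₀ τ₂ hτρ₂ τ₁ hτρ₁ hfP₀ hf0₀ hfP₂ hf0₂ hfP₁ hf0₁ hsplit
    (F0P3cStCharTSK1UnrPseudoCoeffWitness.isPseudoCoeff_epFunction_of_unramified_explicit L v hns w hw hd eA heA νQv mQv hcanQ 𝔇 hμG horb hreg hE hM1 ha τ hτ hU hUo hUc hEo hEc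
      hA0 hA1 d₁ hd₁ P₀ P₂ P₁ hP₀ hP₂ hP₁ r he τ₀ hτρ₀ hτ₀ τ₂ hτρ₂ hτ₂ τ₁ hτρ₁ hτ₁ hfP₀ hf0₀ hfP₂ hf0₂ hfP₁ hf0₁ (IrrClass.mk r) rfl)

end Head

end Summit.HodgeConjecture.HodgeConjecture.Cruxes.H413.F0P3cStCharTSEPNormOneUnr

end
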